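import Mathlib
import Literature.NumberTheory.Transcendental.KZCalculusProofs
import Literature.NumberTheory.Transcendental.SemialgebraicMapsProofs
import Summits.KontsevichZagierPeriods.KontsevichZagierPeriods.Theorems.FurushoPentagonHoffmanRelationInKZCubicalTransportAux2

/-!
# `VolumeFormOffPlane` (stmt-KontsevichZagierPeriods-14935) — line `Sketch`,
stub `stub_cumprodMove` (the cumulative-product chart is one rule-(2) move, `|det| = 1`)

Box dimension `n + 1`, total dimension `n + 2`: box coordinates `x_ι = p (Fin.castSucc ι)`,
slack `z = p (Fin.last (n + 1))`; source cell `S(g) = {x_ι > 1, ∏ x_ι < g, 0 < z, z ∏ x_ι < 1}`,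
target the ordered cell `O(g) = {x₀ < ⋯ < x_n, 1 < x_ι < g, 0 < z, z ∏ x_ι < 1}`. The chart is
`Φ (x, z) = ((x₀ ⋯ x_k)_k, z / J(x))`, `J(x) = ∏_k ∏_{j<k} x_j` (cumulative products — in
logarithmic coordinates the unimodular shear `u ↦ partial sums` — with the slack rescaled so that
`z' ∏ x' = z ∏ x`). Its Jacobian is lower triangular with diagonal `((∏_{j<k} x_j)_k, 1/J(x))`,
so `det Φ' = 1`; `Φ` is a bijection `S(g) → O(g)` (inverse `x_k = x'_k / x'_{k-1}`), polynomial
in the box rows and rational in the slack row, hence `ℚ`-semialgebraic: with integrands `≡ 1`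
this is ONE generator of `KZ.changeOfVariablesRel`. The `ℕ`-indexed partial products
`T m x = x₀ ⋯ x_{m-1}` and the row supports `U k = {j | j ≤ k}` are those of the cubical chart of
`…/Theorems/FurushoPentagonHoffmanRelationInKZCubicalTransportAux*.lean`.

Sources: M. Kontsevich, D. Zagier, *Periods* (2001), §1.2 rule (2); J. Bochnak, M. Coste,
M.-F. Roy, *Real Algebraic Geometry* (1998), §2.2. The Jacobian bookkeeping is folklore.
-/

noncomputable section

open MeasureTheory Set MvPolynomial
open Literature.NumberTheory.Transcendental Literature.ModelTheory.ExponentialFields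
open Summit.KontsevichZagierPeriods.FurushoPentagon.HoffmanRelationInKZ

namespace Summit.KontsevichZagierPeriods.SymplecticScissors.LogPolytope

/-- The determinant of a continuous linear endomorphism of `ℝᴺ` with lower-triangular matrix
(the `i`-th coordinate of the image of `e_j` vanishes for `i < j`) is the product of its diagonal
entries. [folklore] -/
theorem cpm_det_of_lowerTriangular {N : ℕ} (L : (Fin N → ℝ) →L[ℝ] (Fin N → ℝ))
    (hL : ∀ i j : Fin N, i < j → L (Pi.single j 1) i = 0) :
    L.det = ∏ i, L (Pi.single i 1) i := by
  have hentry : ∀ i j, LinearMap.toMatrix' (L : (Fin N → ℝ) →ₗ[ℝ] (Fin N → ℝ)) i j =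
      L (Pi.single j 1) i := fun i j => rfl
  rw [ContinuousLinearMap.det, ← LinearMap.det_toMatrix', Matrix.det_of_lowerTriangular _ ?_]
  · exact Finset.prod_congr rfl fun i _ => hentry i i
  · intro i j hij
    rw [hentry]
    exact hL i j hij

/-- On the box `{1 < xᵢ}` the partial products `T m x = x₀⋯x_{m-1}` satisfy `1 ≤ T m x`,
`1 < T (m+1) x`, are non-decreasing in `m`, and increase while `m < n + 1`. [folklore] -/
theorem cpm_partialProd_mono {n : ℕ} (T : ℕ → (Fin (n + 1) → ℝ) → ℝ)
    (hT : ∀ m x, T m x = ∏ j : Fin (n + 1), if (j : ℕ) < m then x j else 1) {x : Fin (n + 1) → ℝ}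
    (hx : ∀ i, 1 < x i) (m : ℕ) : 1 ≤ T m x ∧ 1 < T (m + 1) x ∧ (∀ d, T m x ≤ T (m + d) x) ∧
      (m < n + 1 → T m x < T (m + 1) x) := by
  have hone : ∀ m, 1 ≤ T m x := fun m => by
    rw [hT]
    exact Finset.one_le_prod fun j _ => by split_ifs; exacts [(hx j).le, le_rfl]
  have hstep : ∀ m, T m x ≤ T (m + 1) x := fun m => by
    rw [partialProd_succ T hT x m]
    split_ifs with h
    · exact le_mul_of_one_le_right (zero_le_one.trans (hone m)) (hx _).le
    · rw [mul_one]
  have hmon : ∀ m d, T m x ≤ T (m + d) x := fun m d => by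
    induction d with
    | zero => simp
    | succ d ih => exact ih.trans (hstep (m + d))
  have h1 : 1 < T 1 x := by
    rw [partialProd_succ T hT, partialProd_zero T hT, one_mul, dif_pos (Nat.succ_pos n)]
    exact hx _
  refine ⟨hone m, h1.trans_le (by rw [add_comm]; exact hmon 1 m), hmon m, fun hm => ?_⟩
  rw [partialProd_succ T hT x m, dif_pos hm]
  exact lt_mul_of_one_lt_right (zero_lt_one.trans_le (hone m)) (hx _)

/-- `T (n+1) x = ∏ᵢ xᵢ` and `∏_k T (k+1) x = (∏_k T k x) · ∏_k x_k`. [folklore] -/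
theorem cpm_partialProd_top {n : ℕ} (T : ℕ → (Fin (n + 1) → ℝ) → ℝ)
    (hT : ∀ m x, T m x = ∏ j : Fin (n + 1), if (j : ℕ) < m then x j else 1)
    (x : Fin (n + 1) → ℝ) : T (n + 1) x = ∏ i, x i ∧
      ∏ k : Fin (n + 1), T ((k : ℕ) + 1) x = (∏ k : Fin (n + 1), T k x) * ∏ k, x k := by
  refine ⟨by rw [hT]; exact Finset.prod_congr rfl fun j _ => if_pos j.isLt, ?_⟩
  rw [← Finset.prod_mul_distrib]
  refine Finset.prod_congr rfl fun k _ => ?_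
  rw [partialProd_succ T hT x k, dif_pos k.isLt]

/-- The partial products of a vector without zero coordinate do not vanish. [folklore] -/
theorem cpm_partialProd_ne_zero {n : ℕ} (T : ℕ → (Fin (n + 1) → ℝ) → ℝ)
    (hT : ∀ m x, T m x = ∏ j : Fin (n + 1), if (j : ℕ) < m then x j else 1) {x : Fin (n + 1) → ℝ}
    (hx : ∀ i, x i ≠ 0) (m : ℕ) : T m x ≠ 0 := by
  rw [hT]
  exact Finset.prod_ne_zero_iff.mpr fun j _ => by split_ifs; exacts [hx j, one_ne_zero]

/-- The inverse of the cumulative-product chart: with `x_0 = t_0`, `x_i = t_i / t_{i-1}`, one has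
`T (m+1) x = t_m`. [folklore] -/
theorem cpm_partialProd_inverse {n : ℕ} (T : ℕ → (Fin (n + 1) → ℝ) → ℝ)
    (hT : ∀ m x, T m x = ∏ j : Fin (n + 1), if (j : ℕ) < m then x j else 1)
    (t : Fin (n + 1) → ℝ) (h0 : ∀ i, 0 < t i) (m : ℕ) (hm : m < n + 1) :
    T (m + 1) (fun i => t i / (if h : (i : ℕ) = 0 then 1 else t ⟨(i : ℕ) - 1, by omega⟩)) =
      t ⟨m, hm⟩ := by
  induction m with
  | zero =>
    rw [partialProd_succ T hT, partialProd_zero T hT, one_mul, dif_pos hm]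
    simp
  | succ m ih =>
    rw [partialProd_succ T hT, ih (by omega), dif_pos hm]
    simp only [Nat.add_eq_zero_iff, one_ne_zero, and_false, ↓reduceDIte, Nat.add_sub_cancel]
    exact mul_div_cancel₀ _ (h0 _).ne'

/-- **Derivative and Jacobian determinant of the cumulative-product chart.** The chart
`Φ (x, z) = ((∏_{j ∈ U k} x_j)_k, z / J(x))`, `J(x) = ∏_k ∏_{j ∈ U k, j ≠ k} x_j`, with row supports
`U k ⊆ {j ≤ k}` containing the diagonal, is differentiable at every point with non-zero box
coordinates, and its derivative — lower triangular with diagonal `((∏_{j ∈ U k, j ≠ k} x_j)_k,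
1/J(x))` — has determinant `J(x)/J(x) = 1`. [folklore] -/
theorem cpm_hasFDerivAt {n : ℕ} (U : Fin (n + 1) → Finset (Fin (n + 1)))
    (hU : ∀ k, U k = Finset.univ.filter (fun j : Fin (n + 1) => (j : ℕ) < (k : ℕ) + 1))
    (Φ : (Fin (n + 1 + 1) → ℝ) → (Fin (n + 1 + 1) → ℝ))
    (hΦ1 : ∀ p (k : Fin (n + 1)), Φ p (Fin.castSucc k) = ∏ j ∈ U k, p (Fin.castSucc j))
    (hΦ2 : ∀ p, Φ p (Fin.last (n + 1)) =
      p (Fin.last (n + 1)) * (∏ k, ∏ j ∈ (U k).erase k, p (Fin.castSucc j))⁻¹) :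
    ∃ Φ' : (Fin (n + 1 + 1) → ℝ) → (Fin (n + 1 + 1) → ℝ) →L[ℝ] (Fin (n + 1 + 1) → ℝ),
      ∀ p, (∀ ι : Fin (n + 1), p (Fin.castSucc ι) ≠ 0) →
        HasFDerivAt Φ (Φ' p) p ∧ (Φ' p).det = 1 := by
  classical
  -- the projection to the box coordinates, the Jacobian denominator `J`, the rows of `Φ'`
  set π : (Fin (n + 1 + 1) → ℝ) →L[ℝ] (Fin (n + 1) → ℝ) := ContinuousLinearMap.pi fun ι =>
    ContinuousLinearMap.proj (R := ℝ) (φ := fun _ : Fin (n + 1 + 1) => ℝ) (Fin.castSucc ι)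
  have hπ : ∀ p ι, π p ι = p (Fin.castSucc ι) := fun p ι => rfl
  set D : (Fin (n + 1) → ℝ) → ℝ := fun x => ∏ k, ∏ j ∈ (U k).erase k, x j
  set R : (Fin (n + 1 + 1) → ℝ) → Fin (n + 1) → (Fin (n + 1 + 1) → ℝ) →L[ℝ] ℝ := fun p k =>
    (∑ j ∈ U k, (∏ j' ∈ (U k).erase j, π p j') •
      ContinuousLinearMap.proj (R := ℝ) (φ := fun _ : Fin (n + 1) => ℝ) j).comp π with hR_def
  set Rl : (Fin (n + 1 + 1) → ℝ) → (Fin (n + 1 + 1) → ℝ) →L[ℝ] ℝ := fun p =>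
    p (Fin.last (n + 1)) • (fderiv ℝ (fun x => (D x)⁻¹) (π p)).comp π + (D (π p))⁻¹ •
      ContinuousLinearMap.proj (R := ℝ) (φ := fun _ : Fin (n + 1 + 1) => ℝ) (Fin.last (n + 1))
    with hRl_def
  refine ⟨fun p => ContinuousLinearMap.pi
    (Fin.snoc (α := fun _ => (Fin (n + 1 + 1) → ℝ) →L[ℝ] ℝ) (R p) (Rl p)), fun p hp => ?_⟩
  have hD0 : D (π p) ≠ 0 :=
    Finset.prod_ne_zero_iff.mpr fun k _ => Finset.prod_ne_zero_iff.mpr fun j _ => hp j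
  have hRap : ∀ k (v : Fin (n + 1 + 1) → ℝ),
      R p k v = ∑ j ∈ U k, (∏ j' ∈ (U k).erase j, π p j') * v (Fin.castSucc j) := fun k v => by
    simp only [hR_def, ContinuousLinearMap.comp_apply, _root_.sum_apply, _root_.smul_apply,
      ContinuousLinearMap.proj_apply, hπ, smul_eq_mul]
  beta_reduce
  constructor
  · refine hasFDerivAt_pi'' fun i => ?_
    rw [ContinuousLinearMap.proj_pi]
    cases i using Fin.lastCases with
    | last =>
      rw [Fin.snoc_last, show (fun q => Φ q (Fin.last (n + 1))) =
        fun q => q (Fin.last (n + 1)) * ((fun x => (D x)⁻¹) ∘ π) q from funext fun q => hΦ2 q]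
      have hDd : HasFDerivAt D _ (π p) :=
        HasFDerivAt.finsetProd (u := Finset.univ)
          (g := fun (k : Fin (n + 1)) (x : Fin (n + 1) → ℝ) => ∏ j ∈ (U k).erase k, x j)
          (g' := fun k => ∑ i ∈ (U k).erase k, (∏ j ∈ ((U k).erase k).erase i, π p j) •
            ContinuousLinearMap.proj (R := ℝ) (φ := fun _ : Fin (n + 1) => ℝ) i)
          fun k _ => hasFDerivAt_finsetProd
      exact (hasFDerivAt_apply (Fin.last (n + 1)) p).fun_mul
        ((hDd.differentiableAt.inv hD0).hasFDerivAt.comp p π.hasFDerivAt)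
    | cast k =>
      rw [Fin.snoc_castSucc, show (fun q => Φ q (Fin.castSucc k)) = (fun x => ∏ j ∈ U k, x j) ∘ π
        from funext fun q => hΦ1 q k]
      exact hasFDerivAt_finsetProd.comp p π.hasFDerivAt
  · have htri : ∀ i j : Fin (n + 1 + 1), i < j → ContinuousLinearMap.pi
        (Fin.snoc (α := fun _ => (Fin (n + 1 + 1) → ℝ) →L[ℝ] ℝ) (R p) (Rl p))
          (Pi.single j 1) i = 0 := by
      intro i j hij
      cases i using Fin.lastCases with
      | last => exact absurd (Fin.le_last j) (not_le.mpr hij)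
      | cast k =>
        rw [ContinuousLinearMap.pi_apply, Fin.snoc_castSucc, hRap]
        refine Finset.sum_eq_zero fun j' hj' => ?_
        have hne : Fin.castSucc j' ≠ j := fun h => by
          rw [← h, Fin.lt_def, Fin.val_castSucc, Fin.val_castSucc] at hij
          simp only [hU, Finset.mem_filter, Finset.mem_univ, true_and] at hj'
          omega
        rw [Pi.single_eq_of_ne hne, mul_zero]
    have hdiag : ∀ k : Fin (n + 1),
        R p k (Pi.single (Fin.castSucc k) 1) = ∏ j' ∈ (U k).erase k, π p j' := by
      intro k
      rw [hRap, Finset.sum_eq_single_of_mem k (by simp [hU])]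
      · rw [Pi.single_eq_same, mul_one]
      · intro j _ hjk
        rw [Pi.single_eq_of_ne (fun h => hjk (Fin.castSucc_injective _ h)), mul_zero]
    have hlast : Rl p (Pi.single (Fin.last (n + 1)) 1) = (D (π p))⁻¹ := by
      have h0 : π (Pi.single (Fin.last (n + 1)) 1) = 0 :=
        funext fun ι => by rw [hπ]; exact Pi.single_eq_of_ne (Fin.castSucc_lt_last ι).ne _
      simp only [hRl_def, _root_.add_apply, _root_.smul_apply,
        ContinuousLinearMap.comp_apply, h0, map_zero, ContinuousLinearMap.proj_apply,
        Pi.single_eq_same, smul_eq_mul, mul_zero, zero_add, mul_one]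
    rw [cpm_det_of_lowerTriangular _ htri, Fin.prod_univ_castSucc]
    simp only [ContinuousLinearMap.pi_apply, Fin.snoc_castSucc, Fin.snoc_last, hdiag, hlast]
    exact mul_inv_cancel₀ hD0

/-- The cumulative-product chart is `ℚ`-semialgebraic on every `ℚ`-semialgebraic set off the
coordinate hyperplanes of the box: its box rows are polynomials and its slack row is a quotient of
polynomials with non-vanishing denominator. [cite: BochnakCosteRoy1998, §2.2] -/
theorem cpm_isSemialgebraicMapOn {n : ℕ} (U : Fin (n + 1) → Finset (Fin (n + 1)))
    (Φ : (Fin (n + 1 + 1) → ℝ) → (Fin (n + 1 + 1) → ℝ))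
    (hΦ1 : ∀ p (k : Fin (n + 1)), Φ p (Fin.castSucc k) = ∏ j ∈ U k, p (Fin.castSucc j))
    (hΦ2 : ∀ p, Φ p (Fin.last (n + 1)) =
      p (Fin.last (n + 1)) * (∏ k, ∏ j ∈ (U k).erase k, p (Fin.castSucc j))⁻¹)
    {σ : Set (Fin (n + 1 + 1) → ℝ)} (hσ : IsSemialgebraic ℚ σ)
    (h0 : ∀ p ∈ σ, ∀ ι : Fin (n + 1), p (Fin.castSucc ι) ≠ 0) : IsSemialgebraicMapOn ℚ σ Φ := by
  classical
  refine IsSemialgebraicMapOn.of_forall hσ fun i => ?_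
  cases i using Fin.lastCases with
  | last =>
    have hq : ∀ p ∈ σ, aeval p (∏ k : Fin (n + 1), ∏ j ∈ (U k).erase k,
        (X (Fin.castSucc j) : MvPolynomial (Fin (n + 1 + 1)) ℚ)) ≠ (0 : ℝ) := fun p hp => by
      simp only [map_prod, aeval_X]
      exact Finset.prod_ne_zero_iff.mpr fun k _ =>
        Finset.prod_ne_zero_iff.mpr fun j _ => h0 p hp j
    exact (isSemialgebraicFunOn_aeval_div_aeval hσ (X (Fin.last (n + 1))) _ hq).congr
      fun p _ => by simp only [map_prod, aeval_X, hΦ2, div_eq_mul_inv]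
  | cast k =>
    exact (isSemialgebraicFunOn_aeval hσ (∏ j ∈ U k,
      (X (Fin.castSucc j) : MvPolynomial (Fin (n + 1 + 1)) ℚ))).congr
        fun p _ => by simp only [map_prod, aeval_X, hΦ1]

/-- The cumulative-product chart is injective off the coordinate hyperplanes of the box (the
cumulative products determine the box coordinates — `x_k · T k x = T (k+1) x` — and then the
slack). [folklore] -/
theorem cpm_injOn {n : ℕ} (T : ℕ → (Fin (n + 1) → ℝ) → ℝ)
    (hT : ∀ m x, T m x = ∏ j : Fin (n + 1), if (j : ℕ) < m then x j else 1)
    (Φ : (Fin (n + 1 + 1) → ℝ) → (Fin (n + 1 + 1) → ℝ))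
    (hΦ1 : ∀ p (k : Fin (n + 1)), Φ p (Fin.castSucc k) =
      T ((k : ℕ) + 1) (fun ι => p (Fin.castSucc ι)))
    (hΦ2 : ∀ p, Φ p (Fin.last (n + 1)) =
      p (Fin.last (n + 1)) * (∏ k : Fin (n + 1), T k (fun ι => p (Fin.castSucc ι)))⁻¹) :
    InjOn Φ {p | ∀ ι : Fin (n + 1), p (Fin.castSucc ι) ≠ 0} := by
  intro p hp q hq hpq
  have hall : ∀ m, m ≤ n + 1 →
      T m (fun ι => p (Fin.castSucc ι)) = T m (fun ι => q (Fin.castSucc ι)) := by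
    intro m hm
    rcases Nat.eq_zero_or_pos m with rfl | hpos
    · rw [partialProd_zero T hT, partialProd_zero T hT]
    · obtain ⟨m', rfl⟩ : ∃ m', m = m' + 1 := ⟨m - 1, by omega⟩
      rw [← hΦ1 p ⟨m', by omega⟩, ← hΦ1 q ⟨m', by omega⟩, hpq]
  have hx : (fun ι => p (Fin.castSucc ι)) = fun ι => q (Fin.castSucc ι) := by
    funext i
    have h1 := hall ((i : ℕ) + 1) i.isLt
    rw [partialProd_succ T hT, partialProd_succ T hT, ← hall i i.isLt.le, dif_pos i.isLt,
      dif_pos i.isLt] at h1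
    exact mul_left_cancel₀ (cpm_partialProd_ne_zero T hT hp i) h1
  have hD : (∏ k : Fin (n + 1), T k fun ι => p (Fin.castSucc ι)) ≠ 0 :=
    Finset.prod_ne_zero_iff.mpr fun k _ => cpm_partialProd_ne_zero T hT hp k
  have hlast : p (Fin.last (n + 1)) = q (Fin.last (n + 1)) := by
    have := congr_fun hpq (Fin.last (n + 1))
    rw [hΦ2, hΦ2, ← hx] at this
    exact mul_right_cancel₀ (inv_ne_zero hD) this
  funext i
  cases i using Fin.lastCases with
  | last => exact hlast
  | cast k => exact congr_fun hx k

/-- **The cumulative-product chart maps the cell `S(g)` onto the ordered cell `O(g)`**: forward,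
the cumulative products of numbers `> 1` increase and end at `∏ x < g`, and the slack identity
`z' · ∏ x' = z · ∏ x` holds; backward, `x_k = x'_k / x'_{k-1} > 1`. [folklore] -/
theorem cpm_image {n : ℕ} (T : ℕ → (Fin (n + 1) → ℝ) → ℝ)
    (hT : ∀ m x, T m x = ∏ j : Fin (n + 1), if (j : ℕ) < m then x j else 1)
    (Φ : (Fin (n + 1 + 1) → ℝ) → (Fin (n + 1 + 1) → ℝ))
    (hΦ1 : ∀ p (k : Fin (n + 1)), Φ p (Fin.castSucc k) =
      T ((k : ℕ) + 1) (fun ι => p (Fin.castSucc ι)))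
    (hΦ2 : ∀ p, Φ p (Fin.last (n + 1)) =
      p (Fin.last (n + 1)) * (∏ k : Fin (n + 1), T k (fun ι => p (Fin.castSucc ι)))⁻¹) (g : ℝ) :
    Φ '' {p : Fin ((n + 1) + 1) → ℝ | (∀ ι : Fin (n + 1), 1 < p (Fin.castSucc ι)) ∧
        ∏ ι : Fin (n + 1), p (Fin.castSucc ι) < g ∧ 0 < p (Fin.last (n + 1)) ∧
        p (Fin.last (n + 1)) * ∏ ι : Fin (n + 1), p (Fin.castSucc ι) < 1} =
      {p : Fin ((n + 1) + 1) → ℝ | StrictMono (fun ι : Fin (n + 1) => p (Fin.castSucc ι)) ∧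
        (∀ ι : Fin (n + 1), 1 < p (Fin.castSucc ι) ∧ p (Fin.castSucc ι) < g) ∧
        0 < p (Fin.last (n + 1)) ∧
        p (Fin.last (n + 1)) * ∏ ι : Fin (n + 1), p (Fin.castSucc ι) < 1} := by
  ext w
  constructor
  · rintro ⟨p, ⟨h1, hg, hz, hz1⟩, rfl⟩
    have hmono := fun m => cpm_partialProd_mono T hT (x := fun ι => p (Fin.castSucc ι)) h1 m
    have hD : 0 < ∏ k : Fin (n + 1), T k (fun ι => p (Fin.castSucc ι)) :=
      Finset.prod_pos fun k _ => one_pos.trans_le (hmono k).1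
    refine ⟨?_, fun ι => ⟨?_, ?_⟩, ?_, ?_⟩
    · refine Fin.strictMono_iff_lt_succ.mpr fun ι => ?_
      show Φ p (Fin.castSucc (Fin.castSucc ι)) < Φ p (Fin.castSucc ι.succ)
      rw [hΦ1, hΦ1, Fin.val_castSucc, Fin.val_succ]
      exact (hmono ((ι : ℕ) + 1)).2.2.2 (by omega)
    · rw [hΦ1]
      exact (hmono ι).2.1
    · rw [hΦ1]
      calc T ((ι : ℕ) + 1) (fun ι => p (Fin.castSucc ι))
          ≤ T ((ι : ℕ) + 1 + (n - ι)) (fun ι => p (Fin.castSucc ι)) := (hmono _).2.2.1 _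
        _ = ∏ ι, p (Fin.castSucc ι) := by
          rw [show (ι : ℕ) + 1 + (n - ι) = n + 1 by omega, (cpm_partialProd_top T hT _).1]
        _ < g := hg
    · rw [hΦ2]
      exact mul_pos hz (inv_pos.mpr hD)
    · rw [hΦ2]
      simp_rw [hΦ1]
      rw [(cpm_partialProd_top T hT _).2, mul_assoc, inv_mul_cancel_left₀ hD.ne']
      exact hz1
  · rintro ⟨hmono, hbd, hz, hz1⟩
    -- the inverse chart
    have ht0 : ∀ ι : Fin (n + 1), 0 < w (Fin.castSucc ι) := fun ι => one_pos.trans (hbd ι).1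
    set x : Fin (n + 1) → ℝ := fun i => w (Fin.castSucc i) /
      (if h : (i : ℕ) = 0 then 1 else w (Fin.castSucc ⟨(i : ℕ) - 1, by omega⟩)) with hx
    have hkey : ∀ m (hm : m < n + 1), T (m + 1) x = w (Fin.castSucc ⟨m, hm⟩) :=
      cpm_partialProd_inverse T hT (fun ι => w (Fin.castSucc ι)) ht0
    have hx1 : ∀ i, 1 < x i := by
      intro i
      simp only [hx]
      split_ifs with h
      · rw [div_one]
        exact (hbd i).1
      · rw [one_lt_div (ht0 _)]
        exact hmono (Fin.lt_def.mpr (Nat.sub_lt (Nat.pos_of_ne_zero h) one_pos))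
    have hDpos : 0 < ∏ k : Fin (n + 1), T k x :=
      Finset.prod_pos fun k _ => one_pos.trans_le (cpm_partialProd_mono T hT hx1 k).1
    have hprod : ∏ i, x i = w (Fin.castSucc (Fin.last n)) := by
      rw [← (cpm_partialProd_top T hT x).1, hkey n (Nat.lt_succ_self n)]
      rfl
    have hprod' : ∏ ι : Fin (n + 1), w (Fin.castSucc ι) =
        (∏ k : Fin (n + 1), T k x) * ∏ k, x k := by
      rw [← (cpm_partialProd_top T hT x).2]
      exact Finset.prod_congr rfl fun k _ => (hkey k k.isLt).symm
    rw [hprod', ← mul_assoc] at hz1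
    refine ⟨Fin.snoc x (w (Fin.last (n + 1)) * ∏ k : Fin (n + 1), T k x), ⟨?_, ?_, ?_, ?_⟩, ?_⟩
    · exact fun ι => by rw [Fin.snoc_castSucc]; exact hx1 ι
    · simp only [Fin.snoc_castSucc]
      exact hprod ▸ (hbd _).2
    · rw [Fin.snoc_last]
      exact mul_pos hz hDpos
    · simpa only [Fin.snoc_castSucc, Fin.snoc_last] using hz1
    · funext i
      cases i using Fin.lastCases with
      | last =>
        rw [hΦ2]
        simp only [Fin.snoc_castSucc, Fin.snoc_last]
        exact mul_inv_cancel_right₀ hDpos.ne' _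
      | cast k =>
        rw [hΦ1]
        simp only [Fin.snoc_castSucc]
        exact hkey k k.isLt

/-- **The cumulative-product move** (stub `stub_cumprodMove` of `VolumeFormOffPlane`, line
`Sketch`, stmt-KontsevichZagierPeriods-14935). In box dimension `n + 1` with one slack coordinate,
two integrand-`1` representations on the cell `S(g) = {x_ι > 1, ∏ x < g, 0 < z, z ∏ x < 1}` and on
the ordered cell `O(g) = {x₀ < ⋯ < x_n, 1 < x_ι < g, 0 < z, z ∏ x < 1}` are KZ-equivalent by ONE
rule-(2) move along the chart `Φ (x, z) = ((x₀⋯x_k)_k, z / ∏_k ∏_{j<k} x_j)`: `Φ` is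
`ℚ`-semialgebraic on `S(g)`, injective, differentiable with Jacobian determinant `1`, and
`Φ '' S(g) = O(g)`, so `1 = 1 · |1|` matches the integrands.
[Kontsevich–Zagier 2001, §1.2, rule (2)] -/
theorem stub_cumprodMove : (∀ (n : ℕ) (g : ℝ) (r r' : KZ.IntegralRep (n + 1 + 1)), r.domain = {p : Fin ((n + 1) + 1) → ℝ | (∀ ι : Fin (n + 1), 1 < p (Fin.castSucc ι)) ∧ ∏ ι : Fin (n + 1), p (Fin.castSucc ι) < g ∧ 0 < p (Fin.last (n + 1)) ∧ p (Fin.last (n + 1)) * ∏ ι : Fin (n + 1), p (Fin.castSucc ι) < 1} → r'.domain = {p : Fin ((n + 1) + 1) → ℝ | StrictMono (fun ι : Fin (n + 1) => p (Fin.castSucc ι)) ∧ (∀ ι : Fin (n + 1), 1 < p (Fin.castSucc ι) ∧ p (Fin.castSucc ι) < g) ∧ 0 < p (Fin.last (n + 1)) ∧ p (Fin.last (n + 1)) * ∏ ι : Fin (n + 1), p (Fin.castSucc ι) < 1} → (∀ p ∈ r.domain, r.integrand p = 1) → (∀ p ∈ r'.domain, r'.integrand p = 1) → KZ.of r - KZ.of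 r' ∈ KZ.relations) := by
  intro n g r r' hdom hdom' hf hf'
  classical
  -- the `ℕ`-indexed partial products of the box coordinates, the row supports, the chart
  obtain ⟨T, hT⟩ : ∃ T : ℕ → (Fin (n + 1) → ℝ) → ℝ,
      ∀ m x, T m x = ∏ j : Fin (n + 1), if (j : ℕ) < m then x j else 1 := ⟨_, fun _ _ => rfl⟩
  obtain ⟨U, hU⟩ : ∃ U : Fin (n + 1) → Finset (Fin (n + 1)),
      ∀ k, U k = Finset.univ.filter (fun j : Fin (n + 1) => (j : ℕ) < (k : ℕ) + 1) :=
    ⟨_, fun _ => rfl⟩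
  obtain ⟨Φ, hΦ1, hΦ2⟩ : ∃ Φ : (Fin (n + 1 + 1) → ℝ) → (Fin (n + 1 + 1) → ℝ),
      (∀ p (k : Fin (n + 1)), Φ p (Fin.castSucc k) = ∏ j ∈ U k, p (Fin.castSucc j)) ∧
      ∀ p, Φ p (Fin.last (n + 1)) =
        p (Fin.last (n + 1)) * (∏ k, ∏ j ∈ (U k).erase k, p (Fin.castSucc j))⁻¹ :=
    ⟨fun p => Fin.snoc (α := fun _ => ℝ) (fun k => ∏ j ∈ U k, p (Fin.castSucc j))
        (p (Fin.last (n + 1)) * (∏ k, ∏ j ∈ (U k).erase k, p (Fin.castSucc j))⁻¹),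
      fun p k => by simp only [Fin.snoc_castSucc], fun p => by simp only [Fin.snoc_last]⟩
  -- the chart in terms of the partial products
  have hΦ1T : ∀ p (k : Fin (n + 1)), Φ p (Fin.castSucc k) =
      T ((k : ℕ) + 1) (fun ι => p (Fin.castSucc ι)) := fun p k =>
    (hΦ1 p k).trans (cubicalChart_apply T hT (fun x i => ∏ j ∈ U i, x j) (fun x i => by rw [hU])
      (fun ι => p (Fin.castSucc ι)) k)
  have hΦ2T : ∀ p, Φ p (Fin.last (n + 1)) =
      p (Fin.last (n + 1)) * (∏ k : Fin (n + 1), T k (fun ι => p (Fin.castSucc ι)))⁻¹ := by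
    intro p
    rw [hΦ2]
    congr 2
    exact Finset.prod_congr rfl fun k _ => by rw [hU]; exact cubicalChart_diag T hT _ k
  -- derivative, Jacobian determinant, positivity of the box coordinates, the image
  obtain ⟨Φ', hΦ'⟩ := cpm_hasFDerivAt U hU Φ hΦ1 hΦ2
  have hpos : ∀ p ∈ r.domain, ∀ ι : Fin (n + 1), 0 < p (Fin.castSucc ι) := fun p hp ι => by
    rw [hdom] at hp
    exact one_pos.trans (hp.1 ι)
  have himage : r'.domain = Φ '' r.domain := by
    rw [hdom, hdom']
    exact (cpm_image T hT Φ hΦ1T hΦ2T g).symm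
  -- the rule-(2) witness: semialgebraic, differentiable, injective, image, `1 = 1 · |1|`
  refine KZ.changeOfVariablesRel_subset_relations ⟨n + 1 + 1, r, r', Φ, Φ',
    cpm_isSemialgebraicMapOn U Φ hΦ1 hΦ2 r.isSemialgebraic_domain fun p hp ι => (hpos p hp ι).ne',
    fun p hp => (hΦ' p fun ι => (hpos p hp ι).ne').1.hasFDerivWithinAt,
    (cpm_injOn T hT Φ hΦ1T hΦ2T).mono fun p hp ι => (hpos p hp ι).ne', himage, ?_, rfl⟩
  intro p hp
  have hp' : Φ p ∈ r'.domain := himage ▸ mem_image_of_mem Φ hp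
  rw [hf p hp, hf' (Φ p) hp', (hΦ' p fun ι => (hpos p hp ι).ne').2, abs_one, mul_one]

end Summit.KontsevichZagierPeriods.SymplecticScissors.LogPolytope

end
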